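/- Copyright: the b2b-balaban cell (near-miss cell 7), T⁴-continuum fan-out; row NE7b ROUND-2 swarm, seat
t4-ne7b-formalise-leaf-01 (gen 9) (road W-RP, offer «W-2T» file 3 — the junction with leaf-04 g7's «4t»
`HistoryChessboardEventsTemplates` p227811; journal INTENT l.17954).  Released under the licence of the surrounding project. -/
import Summits.QuantumFields.BalabanUV.T4Continuum.Support.HistoryChessboardGibbsCells
import Summits.QuantumFields.BalabanUV.T4Continuum.Support.HistoryChessboardEventsTemplates

/-!
# Road W-RP: THE TWO-TERM EVENT MODEL, file 3 — TEMPLATE cell events: (LOC) ∕ (R-sym) ∕ `E_meas` produced by 4t ∕ W3o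

Summits-side support leaf of the T⁴-continuum cell (rung (B)+1 on a FINITE torus only; NOT infinite volume, NOT the
mass gap, NOT the Clay statement; NOT a proof of the spine estimate NE7b).  Row NE7b, road **W-RP**, offer «W-2T», file 3:
the junction of file 1's `CellSide` (the five cell-event clauses of W7's `GibbsCubeSide`) with leaf-04 g7's «4t»
(`HistoryChessboardEventsTemplates`: `cubeCorner`, `tEvent_E_meas_cubes` ∕ `tEvent_loc_cubes` ∕ `tEvent_sym_cubes`) and
W3o ∕ W3o-3 (`HistoryRPTowerTemplates.tEvent` ∕ `towerBox`, `HistoryRPTowerUniform.boxUniform` ∕ `boxUniform_sym` ∕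
`measurableSet_boxUniform`) BY NAME, on W7's Gibbs cube towers (`cubeCount F m₁` cubes of side `L^{m₁}` per direction,
`sitesPerDir_top_eq`).  [folklore] bookkeeping; ONE hypothesis shape (`TemplateCellSide : Prop`, consumed only as a binder)
and one DATA def (`largeBox`, the complement of W3o-3's uniform box template); nothing printed asserted, no `[cite:]` tag, no
`Prop`-valued FACT minted (c1), no constant (c2∕c6), no exit ∕ socket ∕ `HistoryConstants` file touched (c3).

WHAT.  §1 **`structure TemplateCellSide D g₀ hm₁ K P tmpl r : Prop`** — for TEMPLATE cell events `E l c := tEvent K (tmpl l)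
(cubeCorner (sitesPerDir_top_eq F hm₁ K) c)` (the template `tmpl l`, read in the reference column under the top cube at the
origin, carried to the cube `c`): `tmpl_meas` (reference-column measurability, `towerBox G K (L^{m₁}) K`), `tmpl_sym` (the
cube reflection symmetry of every axis, mirror cube `−L^{m₁}·e_i`), (U1)+(G2) `univ_le`, `r_nonneg` — FOUR clauses;
**`TemplateCellSide.cellSide`** (file 1's five-clause `CellSide`, with `E_meas` ∕ `loc` ∕ `sym` PRODUCED by 4t).  §2 the
LARGE-FIELD BOX TEMPLATE **`largeBox F A K m₁ := (boxUniform (F.P K) G A K (L^{m₁}) K)ᶜ`** («some bond of the column under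
the cube lies outside `A`»; `A` = a small-field set, measurable and inversion-symmetric): `measurableSet_largeBox_towerBox`,
`largeBox_sym` (complements inherit W3o-3's `measurableSet_boxUniform` ∕ `boxUniform_sym`), hence
**`cellSide_largeBox`**: for this template the cell side holds from `univ_le` and `r_nonneg` ALONE.  §3 sanity: the
four-clause shape is inhabited on the real tower (no pattern).

CENSUS EFFECT (honest; wording the owner's ∕ typer's).  Composed with files 1–2: for a `CellRoadWitness` whose cell events
are TEMPLATE events, the displayed list per run and cutoff is `tmpl_meas`, `tmpl_sym`, (U1)+(G2) `univ_le`, `r_nonneg` + the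
six inequalities of the aggregate small-field sandwich; for LARGE-FIELD BOX templates (`largeBox`, any measurable
inversion-symmetric `A K ⊆ G`) it is `univ_le` + `r_nonneg` + the sandwich ALONE — i.e. exactly the two located estimates
of road W: the chessboard rate of «every cube of the torus shows a large bond in its column» under the run's Gibbs tower
((U1)+(G2), (B)'s lower half INSIDE as a reading), summable over the cutoff, and NE7's two-run sandwich for the
no-large-cube event.  Which `A K` (Bałaban's small-field conditions are per-level conditions on derivatives of the
averaged fields, not one bond set) is the typing identification; nothing analytic is discharged; NOTHING of the nine;
spine count 0∕9 UNCHANGED; NE7b NOT proved; finite T⁴ only.  HONEST DEPENDENCY (cell): continuum YM on T⁴ ⇐ BetaPertH ∧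
nine spine estimates (0/9 proved); BetaPertH ⇐ (D1) ∧ (D4) ∧ CAP+tail; G-an2-4 gates asym, D1 and NE2/3/4.  This file
changes none of it. -/

open Finset MeasureTheory
open Literature.Barriers.CriticalPhenomena.NonGibbs
open Literature.MathematicalPhysics.QuantumFieldTheory.Balaban1983to89
open Literature.MathematicalPhysics.QuantumFieldTheory.Balaban1983to89.Missing
open Literature.MathematicalPhysics.QuantumFieldTheory.Balaban1983to89.T4Continuum
open Summit.QuantumFields.BalabanUV.T4Continuum
open HistoryRPTowerLaw HistoryRPTowerCuts HistoryRPTowerTemplates HistoryRPTowerUniform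
open HistoryChessboardEventsCubes HistoryChessboardEventsTemplates HistoryChessboardTowerRepr
open HistoryChessboardGibbsSide HistoryChessboardGibbs HistoryChessboardGibbsCells

namespace Summit.QuantumFields.BalabanUV.T4Continuum.HistoryChessboardGibbsCellsTemplates

noncomputable section

/-! ## §1 Template cell events on the Gibbs cube tower: the four-clause side -/

section Template

variable {F : T4Family} {G : Type*} [GaugeGroup G] [MeasurableSpace G] [HaarData G] {Λ : Type*} {m₁ : ℕ}

/-- **THE TEMPLATE CELL SIDE OF ONE RUN AT ONE CUTOFF** (HYPOTHESIS SHAPE — NOTHING asserted): per pattern `l ∈ P` a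
TEMPLATE `tmpl l ⊆ Tower (F.P K) G K` read in the reference column under the top cube of side `L^{m₁}` at the origin; the
cell events are the template events at the cube corners.  Clauses: `tmpl_meas` (reference-column measurability),
`tmpl_sym` (cube reflection symmetry of every axis), (U1)+(G2) `univ_le` (the pattern shown by EVERY cube has probability
`≤ r^(N^4)` under the run's Gibbs tower), `r_nonneg`. [folklore] -/
structure TemplateCellSide (D : FiniteEpsData F G) (g₀ : ℕ → ℝ) {m₁ : ℕ} (hm₁ : m₁ ≤ F.m) (K : ℕ) (P : Finset Λ)
    (tmpl : Λ → Set (Tower (F.P K) G K)) (r : ℝ) : Prop where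
  /-- the templates are measurable in the reference column under the top cube of side `L^{m₁}` -/
  tmpl_meas : ∀ l ∈ P, MeasurableSet[towerBox G K (F.L ^ m₁) K] (tmpl l)
  /-- the templates have the cube reflection symmetry of every axis (mirror cube `−L^{m₁}·e_i`) -/
  tmpl_sym : ∀ l ∈ P, ∀ i : Fin 4,
    (towerRefl i K) ⁻¹' tmpl l = (towerTranslate K (-axisVec (F.P K) K i (F.L ^ m₁))) ⁻¹' tmpl l
  /-- (U1)+(G2), ratio currency: the pattern shown by every cube has probability `≤ r^(N^4)` -/
  univ_le : ∀ l ∈ P,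
    (gibbsTower D g₀ K).real (⋂ c ∈ (Finset.univ : Finset (BlockIdx 4 (cubeCount F m₁))),
      tEvent K (tmpl l) (cubeCorner (sitesPerDir_top_eq F hm₁ K) c)) ≤ r ^ (cubeCount F m₁ ^ 4)
  /-- the per-cell rate is nonnegative -/
  r_nonneg : 0 ≤ r

variable {D : FiniteEpsData F G} {g₀ : ℕ → ℝ} {hm₁ : m₁ ≤ F.m} {K : ℕ} {P : Finset Λ}
  {tmpl : Λ → Set (Tower (F.P K) G K)} {r : ℝ}

/-- **THE TEMPLATE CELL SIDE IS A CELL SIDE**: `E_meas` ∕ `loc` ∕ `sym` for the template events at the cube corners by 4t's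
`tEvent_E_meas_cubes` ∕ `tEvent_loc_cubes` ∕ `tEvent_sym_cubes` (level range `K ≤ m + K` automatic), `univ_le` ∕ `r_nonneg`
verbatim. [folklore] -/
theorem TemplateCellSide.cellSide (H : TemplateCellSide D g₀ hm₁ K P tmpl r) :
    CellSide D g₀ hm₁ K P (fun l c => tEvent K (tmpl l) (cubeCorner (sitesPerDir_top_eq F hm₁ K) c)) r where
  E_meas := tEvent_E_meas_cubes (sitesPerDir_top_eq F hm₁ K) fun l hl => measurableSet_of_towerBox (H.tmpl_meas l hl)
  loc := tEvent_loc_cubes (Nat.le_add_left K F.m) (sitesPerDir_top_eq F hm₁ K) H.tmpl_meas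
  sym := tEvent_sym_cubes (sitesPerDir_top_eq F hm₁ K) H.tmpl_sym
  univ_le := H.univ_le
  r_nonneg := H.r_nonneg

/-- … hence W7's eleven-clause `GibbsCubeSide` for the two-term model over template cell events, every loop string.
[folklore] -/
theorem TemplateCellSide.gibbsCubeSide (H : TemplateCellSide D g₀ hm₁ K P tmpl r) (os : List (ULoop F)) :
    GibbsCubeSide D g₀ os hm₁ K P (Finset.univ : Finset Bool)
      (weight D g₀ os K (twoEv P fun l c => tEvent K (tmpl l) (cubeCorner (sitesPerDir_top_eq F hm₁ K) c))) {true}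
      (twoEv P fun l c => tEvent K (tmpl l) (cubeCorner (sitesPerDir_top_eq F hm₁ K) c))
      (fun l c => tEvent K (tmpl l) (cubeCorner (sitesPerDir_top_eq F hm₁ K) c)) r :=
  H.cellSide.gibbsCubeSide os

end Template

/-! ## §2 The large-field box template: only `univ_le` and `r_nonneg` stay -/

section LargeBox

variable (F : T4Family) {G : Type*}

/-- **THE LARGE-FIELD BOX TEMPLATE** of cutoff `K` and cube side `L^{m₁}`: «SOME bond of the reference column under the
top cube lies OUTSIDE `A`» — the complement of W3o-3's uniform box template `boxUniform (F.P K) G A K (L^{m₁}) K` («every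
bond of the column lies in `A`»). -/
def largeBox (A : Set G) (K m₁ : ℕ) : Set (Tower (F.P K) G K) := (boxUniform (F.P K) G A K (F.L ^ m₁) K)ᶜ

variable {F}

/-- `tmpl_meas` for the large-field box template (measurable `A`). [folklore] -/
theorem measurableSet_largeBox_towerBox [MeasurableSpace G] {A : Set G} (hA : MeasurableSet A) (K m₁ : ℕ) :
    MeasurableSet[towerBox G K (F.L ^ m₁) K] (largeBox F A K m₁) :=
  (measurableSet_boxUniform hA K (F.L ^ m₁) K).compl

variable [GaugeGroup G]

/-- the cube side divides the torus: `L^{m₁} ≤ N_K` (`m₁ ≤ m`). [folklore] -/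
theorem pow_le_sitesPerDir {m₁ : ℕ} (hm₁ : m₁ ≤ F.m) (K : ℕ) : F.L ^ m₁ ≤ (F.P K).sitesPerDir K := by
  rw [sitesPerDir_top_eq F hm₁ K]
  exact Nat.le_mul_of_pos_right _ (Nat.pos_of_ne_zero (NeZero.ne _))

/-- `tmpl_sym` for the large-field box template (inversion-symmetric `A`): complements inherit W3o-3's `boxUniform_sym`.
[folklore] -/
theorem largeBox_sym {A : Set G} (hA : ∀ g : G, g⁻¹ ∈ A ↔ g ∈ A) {m₁ : ℕ} (hm₁ : m₁ ≤ F.m) (K : ℕ) (i : Fin 4) :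
    (towerRefl i K) ⁻¹' largeBox F A K m₁ =
      (towerTranslate K (-axisVec (F.P K) K i (F.L ^ m₁))) ⁻¹' largeBox F A K m₁ := by
  simp only [largeBox, Set.preimage_compl, boxUniform_sym hA (pow_le_sitesPerDir hm₁ K) (Nat.le_add_left K F.m) i]

variable [MeasurableSpace G] [HaarData G]

/-- **FOR LARGE-FIELD BOX TEMPLATES THE CELL SIDE HOLDS FROM `univ_le` AND `r_nonneg` ALONE** (one template per pattern,
sets `A l` measurable and inversion-symmetric): `tmpl_meas` ∕ `tmpl_sym` DISCHARGED by W3o-3. [folklore] -/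
theorem templateCellSide_largeBox (D : FiniteEpsData F G) (g₀ : ℕ → ℝ) {m₁ : ℕ} (hm₁ : m₁ ≤ F.m) (K : ℕ)
    {Λ : Type*} (P : Finset Λ) {A : Λ → Set G} (hAm : ∀ l ∈ P, MeasurableSet (A l))
    (hAi : ∀ l ∈ P, ∀ g : G, g⁻¹ ∈ A l ↔ g ∈ A l) {r : ℝ} (hr : 0 ≤ r)
    (huniv : ∀ l ∈ P,
      (gibbsTower D g₀ K).real (⋂ c ∈ (Finset.univ : Finset (BlockIdx 4 (cubeCount F m₁))),
        tEvent K (largeBox F (A l) K m₁) (cubeCorner (sitesPerDir_top_eq F hm₁ K) c)) ≤ r ^ (cubeCount F m₁ ^ 4)) :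
    TemplateCellSide D g₀ hm₁ K P (fun l => largeBox F (A l) K m₁) r where
  tmpl_meas l hl := measurableSet_largeBox_towerBox (hAm l hl) K m₁
  tmpl_sym l hl i := largeBox_sym (hAi l hl) hm₁ K i
  univ_le := huniv
  r_nonneg := hr

/-- … and therefore file 1's five-clause `CellSide` for the large-field box events at the cube corners. [folklore] -/
theorem cellSide_largeBox (D : FiniteEpsData F G) (g₀ : ℕ → ℝ) {m₁ : ℕ} (hm₁ : m₁ ≤ F.m) (K : ℕ)
    {Λ : Type*} (P : Finset Λ) {A : Λ → Set G} (hAm : ∀ l ∈ P, MeasurableSet (A l))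
    (hAi : ∀ l ∈ P, ∀ g : G, g⁻¹ ∈ A l ↔ g ∈ A l) {r : ℝ} (hr : 0 ≤ r)
    (huniv : ∀ l ∈ P,
      (gibbsTower D g₀ K).real (⋂ c ∈ (Finset.univ : Finset (BlockIdx 4 (cubeCount F m₁))),
        tEvent K (largeBox F (A l) K m₁) (cubeCorner (sitesPerDir_top_eq F hm₁ K) c)) ≤ r ^ (cubeCount F m₁ ^ 4)) :
    CellSide D g₀ hm₁ K P
      (fun l c => tEvent K (largeBox F (A l) K m₁) (cubeCorner (sitesPerDir_top_eq F hm₁ K) c)) r :=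
  (templateCellSide_largeBox D g₀ hm₁ K P hAm hAi hr huniv).cellSide

end LargeBox

/-! ## §3 Sanity: the four-clause shape is inhabited on the real tower -/

namespace Sanity

variable {F : T4Family} {G : Type*} [GaugeGroup G] [MeasurableSpace G] [HaarData G]

/-- With NO pattern the template cell side holds at every cutoff with rate `0` (node test of the SHAPE). [folklore] -/
example (D : FiniteEpsData F G) (g₀ : ℕ → ℝ) {m₁ : ℕ} (hm₁ : m₁ ≤ F.m) (K : ℕ)
    (tmpl : Unit → Set (Tower (F.P K) G K)) : TemplateCellSide D g₀ hm₁ K ∅ tmpl 0 where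
  tmpl_meas _ h := (Finset.notMem_empty _ h).elim
  tmpl_sym _ h := (Finset.notMem_empty _ h).elim
  univ_le _ h := (Finset.notMem_empty _ h).elim
  r_nonneg := le_rfl

/-- With ONE pattern and the large-field box template of the WHOLE group (`A := ∅`: every bond is «large»), the template
cell side holds with rate `1` — `univ_le` by `μ.real ≤ 1` for the probability measure `gibbsTower`. [folklore] -/
example (D : FiniteEpsData F G) [RegularGaugeGroup G] (hM : D.AvgMeasurable) (g₀ : ℕ → ℝ) {m₁ : ℕ} (hm₁ : m₁ ≤ F.m)
    (K : ℕ) : TemplateCellSide D g₀ hm₁ K ({()} : Finset Unit) (fun _ => largeBox F (∅ : Set G) K m₁) 1 :=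
  haveI := isProbabilityMeasure_gibbsTower D hM g₀ K
  templateCellSide_largeBox D g₀ hm₁ K {()} (fun _ _ => MeasurableSet.empty) (fun _ _ _ => Iff.rfl) zero_le_one
    fun _ _ => by
      rw [one_pow]
      exact (measureReal_mono (Set.subset_univ _) (measure_ne_top _ _)).trans_eq (by simp)

end Sanity

end

end Summit.QuantumFields.BalabanUV.T4Continuum.HistoryChessboardGibbsCellsTemplates
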